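import Mathlib
import Summits.ValiantsHypothesis.ValiantsHypothesis.Theses.BarrierLever
import Summits.ValiantsHypothesis.ValiantsHypothesis.Theorems.BarrierLeverDefinableEquationsBalancedStrength
import Summits.ValiantsHypothesis.ValiantsHypothesis.Theorems.BarrierLeverDefinableEquationsBalancedStrengthThin
import Summits.ValiantsHypothesis.ValiantsHypothesis.Theorems.DetqpThesis.Negative.IffPerNotVQP
import Summits.ValiantsHypothesis.ValiantsHypothesis.Theorems.BarrierLeverDcSliceCoversVP
import Summits.ValiantsHypothesis.ValiantsHypothesis.Theorems.BarrierLeverSingleSizeEquationsReductions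
import HarnessLib

/-!
# Support `BarrierLever.DefinableDcEquations` (stmt-ValiantsHypothesis-8746) — the STRENGTH DOOR
# serves the whole docket: the determinantal slice `dc ≤ 2^{(log₂ n+1)³}` has balanced strength
# `≤ 2^{8(log₂ n+1)³}`, that class is still THIN, and explicit equations for it give 8746 (⇒ 8745 ⇒ 8749)

Seat val-np-p5 (gen 21), third file of the strength axis (siblings:
`BarrierLeverDefinableEquationsBalancedStrength.lean` — small circuits have polynomially bounded
balanced strength, door to 8745/8749; `…BalancedStrengthThin.lean` — the class `BP(n, s)` of
polynomials whose every homogeneous component `hom_d f` is a sum of `< s` products `g·h` with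
`deg g, deg h ≤ ⌊(2d+2)/3⌋` is thin when `2s·C(n+⌊(2n+2)/3⌋, n) < C(2n−1, n)`).

* `dcSlice_subset_balanced` — `deg f ≤ n ∧ dc f ≤ m ⇒ f ∈ BP(n, N)` for every
  `N ≥ 4·(8(m+1)^7 + m²(2n+1))·(n+1)² + 1` (Berkowitz-type bound `L(f) ≤ 8(dc f+1)^7 + dc(f)²(2n+1)`,
  tree `complexity_le_of_determinantalComplexity`, then the sibling's
  `exists_balanced_of_complexity_le`).
* `threshold_admissible` — `m(n) = 2^{(log₂ n + 1)³}` satisfies the growth clause of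
  `DefinableDcEquations` (`2^{C(log₂ n+1)²} ≤ m(n)` for `n ≥ 2^C`); `dcSlice_subset_balanced_log3` —
  for `n ≥ 4`, `{deg ≤ n, dc ≤ 2^{(log₂ n+1)³}} ⊆ BP(n, 2^{8(log₂ n+1)³})`.
* THE DOOR FOR 8746: `definableDcEquations_of_balanced_equations` — level-`a` Boolean-sum equations
  vanishing on `BP(n, 2^{8(log₂ n+1)³})`, eventually in `n`, prove the route decl
  `BarrierLever.DefinableDcEquations` (hence `DefinableEquations`, `SingleSizeEquations` by the
  tree's arrows).  ONE circuit-free target for all three docket items.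
* §5 (appended) `definableEquations_of_balanced_equations_log3`,
  `singleSizeEquations_of_balanced_equations_log3` — the same hypothesis gives the crux
  `DefinableEquations` (8745) and `SingleSizeEquations` (8749) through the tree's glue.
* NON-VACUITY at this super-polynomial size: `exists_equation_of_lt_two_pow` (the count holds as
  soon as `2s < 2^{n−1−⌊(2n+2)/3⌋}`, from the sibling's Pascal-step bound) and
  `exists_equation_log3` — eventually in `n` a NONZERO polynomial in the `C(2n,n)` coefficient
  variables vanishes on `BP(n, 2^{8(log₂ n+1)³})` (so also on the whole slice `dc ≤ 2^{(log₂ n+1)³}`: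
  `exists_equation_dcSlice_log3`).

Honest framing: a DOOR and its non-vacuity; no explicit equation; 8746 (like 8745/8749) stays OPEN;
in print, equations for bounded strength are known only up to strength `(#variables)/2`
(singular locus; Ruppert-type syzygies, arXiv:2509.12322), far below `2^{8(log₂ n+1)³}`.  Nothing
here bears on crux 14610 or on `VP ≠ VNP`, which is NOT proved.  No definitions, no named-fact
hypotheses, standard axioms.

References: Valiant–Skyum–Berkowitz–Rackoff 1983 (frontier identity); S. J. Berkowitz, Inform.
Process. Lett. 18 (1984) / Bürgisser 2000 Rem. 2.7 (circuits for the determinant); Mignon–Ressayre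
2004 (dc); Ananyan–Hochster 2020, GGIL 2022 (strength); Forbes–Shpilka–Volk 2018, Def. 1.
-/

set_option linter.dupNamespace false

noncomputable section

namespace Summit.ValiantsHypothesis.ValiantsHypothesis.Theorems.BarrierLeverDefinableEquations

open MvPolynomial
open Literature.Computability.AlgebraicComplexity Literature.Barriers.ValiantsHypothesis
open Summit.ValiantsHypothesis.Theorems.DetqpThesis.Negative (complexity_le_of_determinantalComplexity)
open scoped BigOperators

namespace BalancedStrength

/-! ## §1 The determinantal slice has bounded balanced strength -/

/-- **`dc f ≤ m ⇒ f ∈ BP(n, N)`** for `N ≥ 4(8(m+1)^7 + m²(2n+1))(n+1)² + 1`: an affine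
determinantal expression of size `m` has circuit size `≤ 8(m+1)^7 + m²(2n+1)` (Berkowitz), hence
(sibling file) every homogeneous component is a sum of `≤ N` balanced products.
[cite: Burgisser2000, Rem. 2.7; ValiantSkyumBerkowitzRackoff1983, frontier identity] -/
theorem dcSlice_subset_balanced {n m N : ℕ}
    (hN : 4 * (8 * (m + 1) ^ 7 + m ^ 2 * (2 * n + 1)) * (n + 1) ^ 2 + 1 ≤ N) :
    {f : MvPolynomial (Fin n) ℂ | f.totalDegree ≤ n ∧ determinantalComplexity f ≤ m} ⊆
      {f : MvPolynomial (Fin n) ℂ | f.totalDegree ≤ n ∧ ∀ d : ℕ,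
        ∃ g h : Fin N → MvPolynomial (Fin n) ℂ,
          (∀ i, (g i).totalDegree ≤ (2 * d + 2) / 3 ∧ (h i).totalDegree ≤ (2 * d + 2) / 3) ∧
          homogeneousComponent d f = ∑ i, g i * h i} := by
  rintro f ⟨hdeg, hdc⟩
  have hcx : complexity f ≤ 8 * (m + 1) ^ 7 + m ^ 2 * (2 * n + 1) := by
    refine (complexity_le_of_determinantalComplexity f).trans ?_
    rw [Fintype.card_fin]
    have h7 : (determinantalComplexity f + 1) ^ 7 ≤ (m + 1) ^ 7 :=
      Nat.pow_le_pow_left (by omega) 7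
    have h2 : determinantalComplexity f ^ 2 ≤ m ^ 2 := Nat.pow_le_pow_left hdc 2
    exact Nat.add_le_add (Nat.mul_le_mul_left _ h7) (Nat.mul_le_mul_right _ h2)
  refine ⟨hdeg, fun d => ?_⟩
  by_cases hd : d ≤ n
  · refine exists_balanced_of_complexity_le f hcx (le_trans ?_ hN)
    have : (d + 1) ^ 2 ≤ (n + 1) ^ 2 := Nat.pow_le_pow_left (by omega) 2
    have := Nat.mul_le_mul_left (4 * (8 * (m + 1) ^ 7 + m ^ 2 * (2 * n + 1))) this
    omega
  · refine exists_balanced_of_totalDegree_le (by omega) f ?_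
    rw [homogeneousComponent_eq_zero _ _ (by omega)]
    simp

/-! ## §2 The threshold `m(n) = 2^{(log₂ n + 1)³}` -/

/-- **Admissibility**: `m(n) = 2^{(log₂ n + 1)³}` meets the growth clause of `DefinableDcEquations`
— for every `C` and all `n ≥ 2^C`, `2^{C (log₂ n + 1)²} ≤ 2^{(log₂ n + 1)³}`. [folklore] -/
theorem threshold_admissible (C : ℕ) : ∃ n₀ : ℕ, ∀ n ≥ n₀,
    2 ^ (C * (Nat.log 2 n + 1) ^ 2) ≤ 2 ^ ((Nat.log 2 n + 1) ^ 3) := by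
  refine ⟨2 ^ C, fun n hn => Nat.pow_le_pow_right (by norm_num) ?_⟩
  have hlog : C ≤ Nat.log 2 n := by
    have := Nat.log_mono_right (b := 2) hn
    rwa [Nat.log_pow (by norm_num)] at this
  calc C * (Nat.log 2 n + 1) ^ 2 ≤ (Nat.log 2 n + 1) * (Nat.log 2 n + 1) ^ 2 :=
        Nat.mul_le_mul_right _ (by omega)
    _ = (Nat.log 2 n + 1) ^ 3 := by ring

/-- Size bookkeeping: with `t = log₂ n` (so `n < 2^{t+1}`), `t ≥ 2`, and `m = 2^{(t+1)³}`:
`4(8(m+1)^7 + m²(2n+1))(n+1)² + 1 ≤ 2^{8(t+1)³}`. [folklore] -/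
theorem size_le_two_pow {n t : ℕ} (ht : 2 ≤ t) (hn : n < 2 ^ (t + 1)) :
    4 * (8 * (2 ^ ((t + 1) ^ 3) + 1) ^ 7 + (2 ^ ((t + 1) ^ 3)) ^ 2 * (2 * n + 1)) * (n + 1) ^ 2 + 1
      ≤ 2 ^ (8 * (t + 1) ^ 3) := by
  set u := (t + 1) ^ 3 with hu
  have hu27 : 27 ≤ u := by
    have : 3 ^ 3 ≤ (t + 1) ^ 3 := Nat.pow_le_pow_left (by omega) 3
    simpa [hu] using this
  have hut : 2 * t + 16 ≤ u := by
    have h3 : (t + 1) ^ 3 = (t + 1) * (t + 1) * (t + 1) := by ring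
    nlinarith [h3]
  -- elementary bounds in powers of two
  have hm1 : 2 ^ u + 1 ≤ 2 ^ (u + 1) := by
    have : 1 ≤ 2 ^ u := Nat.one_le_two_pow
    rw [pow_succ]; omega
  have hn1 : n + 1 ≤ 2 ^ (t + 1) := hn
  have h2n1 : 2 * n + 1 ≤ 2 ^ (t + 2) := by rw [pow_succ]; omega
  have hA : 8 * (2 ^ u + 1) ^ 7 ≤ 2 ^ (7 * u + 10) := by
    calc 8 * (2 ^ u + 1) ^ 7 ≤ 8 * (2 ^ (u + 1)) ^ 7 := Nat.mul_le_mul_left _ (Nat.pow_le_pow_left hm1 7)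
      _ = 2 ^ (7 * u + 10) := by rw [← pow_mul, show (8 : ℕ) = 2 ^ 3 by norm_num, ← pow_add]; ring_nf
  have hB : (2 ^ u) ^ 2 * (2 * n + 1) ≤ 2 ^ (2 * u + t + 2) := by
    calc (2 ^ u) ^ 2 * (2 * n + 1) ≤ (2 ^ u) ^ 2 * 2 ^ (t + 2) := Nat.mul_le_mul_left _ h2n1
      _ = 2 ^ (2 * u + t + 2) := by rw [← pow_mul, ← pow_add]; ring_nf
  have hC : (n + 1) ^ 2 ≤ 2 ^ (2 * t + 2) := by
    calc (n + 1) ^ 2 ≤ (2 ^ (t + 1)) ^ 2 := Nat.pow_le_pow_left hn1 2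
      _ = 2 ^ (2 * t + 2) := by rw [← pow_mul]; ring_nf
  have hAB : 8 * (2 ^ u + 1) ^ 7 + (2 ^ u) ^ 2 * (2 * n + 1) ≤ 2 ^ (7 * u + 11) := by
    have h1 : 2 ^ (2 * u + t + 2) ≤ 2 ^ (7 * u + 10) := Nat.pow_le_pow_right (by norm_num) (by omega)
    calc 8 * (2 ^ u + 1) ^ 7 + (2 ^ u) ^ 2 * (2 * n + 1) ≤ 2 ^ (7 * u + 10) + 2 ^ (7 * u + 10) :=
          Nat.add_le_add hA (hB.trans h1)
      _ = 2 ^ (7 * u + 11) := by rw [← two_mul, ← pow_succ']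
  calc 4 * (8 * (2 ^ u + 1) ^ 7 + (2 ^ u) ^ 2 * (2 * n + 1)) * (n + 1) ^ 2 + 1
      ≤ 4 * 2 ^ (7 * u + 11) * 2 ^ (2 * t + 2) + 1 :=
        Nat.add_le_add_right (Nat.mul_le_mul (Nat.mul_le_mul_left _ hAB) hC) _
    _ = 2 ^ (7 * u + 2 * t + 15) + 1 := by
        rw [show (4 : ℕ) = 2 ^ 2 by norm_num, ← pow_add, ← pow_add]; ring_nf
    _ ≤ 2 ^ (7 * u + 2 * t + 15) + 2 ^ (7 * u + 2 * t + 15) :=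
        Nat.add_le_add_left Nat.one_le_two_pow _
    _ = 2 ^ (7 * u + 2 * t + 16) := by rw [← two_mul, ← pow_succ']
    _ ≤ 2 ^ (8 * u) := Nat.pow_le_pow_right (by norm_num) (by omega)

/-- **The slice `dc ≤ 2^{(log₂ n+1)³}` has balanced strength `≤ 2^{8(log₂ n+1)³}`** (for `n ≥ 4`).
[cite: Burgisser2000, Rem. 2.7; ValiantSkyumBerkowitzRackoff1983, frontier identity] -/
theorem dcSlice_subset_balanced_log3 {n : ℕ} (hn : 4 ≤ n) :
    {f : MvPolynomial (Fin n) ℂ | f.totalDegree ≤ n ∧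
        determinantalComplexity f ≤ 2 ^ ((Nat.log 2 n + 1) ^ 3)} ⊆
      {f : MvPolynomial (Fin n) ℂ | f.totalDegree ≤ n ∧ ∀ d : ℕ,
        ∃ g h : Fin (2 ^ (8 * (Nat.log 2 n + 1) ^ 3)) → MvPolynomial (Fin n) ℂ,
          (∀ i, (g i).totalDegree ≤ (2 * d + 2) / 3 ∧ (h i).totalDegree ≤ (2 * d + 2) / 3) ∧
          homogeneousComponent d f = ∑ i, g i * h i} := by
  have ht : 2 ≤ Nat.log 2 n := by
    have := Nat.log_mono_right (b := 2) (show 2 ^ 2 ≤ n by omega)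
    rwa [Nat.log_pow (by norm_num)] at this
  exact dcSlice_subset_balanced (size_le_two_pow ht (Nat.lt_pow_succ_log_self (by norm_num) n))

/-! ## §3 The door for `DefinableDcEquations` -/

/-- **The strength door for 8746.**  If for some level `a`, eventually in `n`, a nonzero level-`a`
Boolean sum in the `N = C(2n,n)` coefficient variables vanishes at `coeff f` for every
`f ∈ BP(n, 2^{8(log₂ n+1)³})`, then `BarrierLever.DefinableDcEquations` holds (with the admissible
threshold `m(n) = 2^{(log₂ n+1)³}`), hence `DefinableEquations` and `SingleSizeEquations` by the
tree's `definableEquations_of_definableDcEquations` / `singleSizeEquations_of_definableEquations`.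
[cite: ForbesShpilkaVolk2018, Def. 1; ValiantSkyumBerkowitzRackoff1983, frontier identity] -/
theorem definableDcEquations_of_balanced_equations
    (hE : ∃ a n₀ : ℕ, ∀ n ≥ n₀, ∃ q : ℕ, q ≤ (Nat.choose (2 * n) n) ^ a ∧
      ∃ H : MvPolynomial (↥(degLEMonomials n) ⊕ Fin q) ℂ,
        complexity H ≤ (Nat.choose (2 * n) n) ^ a ∧ H.totalDegree ≤ (Nat.choose (2 * n) n) ^ a ∧
        boolSum H ≠ 0 ∧
        ∀ f ∈ {f : MvPolynomial (Fin n) ℂ | f.totalDegree ≤ n ∧ ∀ d : ℕ,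
            ∃ g h : Fin (2 ^ (8 * (Nat.log 2 n + 1) ^ 3)) → MvPolynomial (Fin n) ℂ,
              (∀ i, (g i).totalDegree ≤ (2 * d + 2) / 3 ∧ (h i).totalDegree ≤ (2 * d + 2) / 3) ∧
              homogeneousComponent d f = ∑ i, g i * h i},
          eval (coeffVector (degLEMonomials n) f) (boolSum H) = 0) :
    Summit.ValiantsHypothesis.ValiantsHypothesis.Theses.BarrierLever.DefinableDcEquations := by
  obtain ⟨a, n₀, h⟩ := hE
  refine ⟨fun n => 2 ^ ((Nat.log 2 n + 1) ^ 3), threshold_admissible, a, max n₀ 4, fun n hn => ?_⟩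
  obtain ⟨q, hq, H, hc, hd, hne, hvan⟩ := h n (le_of_max_le_left hn)
  refine ⟨q, hq, H, hc, hd, hne, fun f hfdeg hfdc => ?_⟩
  exact hvan f (dcSlice_subset_balanced_log3 (le_of_max_le_right hn) ⟨hfdeg, hfdc⟩)

/-! ## §4 Non-vacuity at super-polynomial strength -/

/-- **Thinness for any `s` below the exponential gap**: if `n ≥ 5` and
`2s < 2^{n − 1 − ⌊(2n+2)/3⌋}` then a nonzero polynomial in the coefficient variables vanishes on
`BP(n, s)` (the sibling's count `2s·C(n+⌊(2n+2)/3⌋, n) < C(2n−1, n)` via Pascal steps).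
[cite: HeintzSchnorr1980, existence of equations by dimension count] -/
theorem exists_equation_of_lt_two_pow {n s : ℕ} (hn : 5 ≤ n)
    (hs : 2 * s < 2 ^ (n - 1 - (2 * n + 2) / 3)) :
    ∃ D : MvPolynomial (degLEMonomials n) ℂ, D ≠ 0 ∧
      ∀ f ∈ {f : MvPolynomial (Fin n) ℂ | f.totalDegree ≤ n ∧ ∀ d : ℕ,
          ∃ g h : Fin s → MvPolynomial (Fin n) ℂ,
            (∀ i, (g i).totalDegree ≤ (2 * d + 2) / 3 ∧ (h i).totalDegree ≤ (2 * d + 2) / 3) ∧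
            homogeneousComponent d f = ∑ i, g i * h i},
        eval (coeffVector (degLEMonomials n) f) D = 0 := by
  apply exists_equation_of_count
  set A := (2 * n + 2) / 3 with hA
  have hiter := two_pow_mul_choose_le (n := n) (M := n + A) (by omega) (by omega) (n - 1 - A)
    (by omega)
  rw [show n + A + (n - 1 - A) = 2 * n - 1 by omega] at hiter
  have hpos : 0 < (n + A).choose n := Nat.choose_pos (by omega)
  calc 2 * s * (n + A).choose n < 2 ^ (n - 1 - A) * (n + A).choose n :=
        Nat.mul_lt_mul_of_pos_right hs hpos
    _ ≤ (2 * n - 1).choose n := hiter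

/-- **Non-vacuity of the 8746 door**: eventually in `n`, a NONZERO polynomial in the `C(2n,n)`
coefficient variables vanishes on `BP(n, 2^{8(log₂ n+1)³})` (`8(log₂ n+1)³ + 1 < (n−5)/3`
eventually). [cite: HeintzSchnorr1980, existence of equations by dimension count] -/
theorem exists_equation_log3 : ∃ n₀ : ℕ, ∀ n ≥ n₀,
    ∃ D : MvPolynomial (degLEMonomials n) ℂ, D ≠ 0 ∧
      ∀ f ∈ {f : MvPolynomial (Fin n) ℂ | f.totalDegree ≤ n ∧ ∀ d : ℕ,
          ∃ g h : Fin (2 ^ (8 * (Nat.log 2 n + 1) ^ 3)) → MvPolynomial (Fin n) ℂ,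
            (∀ i, (g i).totalDegree ≤ (2 * d + 2) / 3 ∧ (h i).totalDegree ≤ (2 * d + 2) / 3) ∧
            homogeneousComponent d f = ∑ i, g i * h i},
        eval (coeffVector (degLEMonomials n) f) D = 0 := by
  obtain ⟨m₀, hm₀⟩ := eventually_mul_pow_lt_two_pow 3 50
  refine ⟨2 ^ (m₀ + 3), fun n hn => exists_equation_of_lt_two_pow ?_ ?_⟩
  · have : 2 ^ 3 ≤ 2 ^ (m₀ + 3) := Nat.pow_le_pow_right (by norm_num) (by omega)
    omega
  · set t := Nat.log 2 n with htdef
    have ht : m₀ + 3 ≤ t := by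
      have := Nat.log_mono_right (b := 2) hn
      rwa [Nat.log_pow (by norm_num)] at this
    have hnt : 2 ^ t ≤ n := Nat.pow_log_le_self 2 (by
      have : 1 ≤ 2 ^ (m₀ + 3) := Nat.one_le_two_pow; omega)
    have hkey : 50 * (t + 1) ^ 3 < 2 ^ (t + 1) := hm₀ (t + 1) (by omega)
    -- `8(t+1)^3 + 2 ≤ n - 1 - ⌊(2n+2)/3⌋`
    have hexp : 8 * (t + 1) ^ 3 + 2 ≤ n - 1 - (2 * n + 2) / 3 := by
      have h27 : 27 ≤ (t + 1) ^ 3 := by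
        have : 3 ^ 3 ≤ (t + 1) ^ 3 := Nat.pow_le_pow_left (by omega) 3
        simpa using this
      have h2 : 2 ^ (t + 1) = 2 * 2 ^ t := by ring
      rw [h2] at hkey
      omega
    calc 2 * 2 ^ (8 * (t + 1) ^ 3) = 2 ^ (8 * (t + 1) ^ 3 + 1) := by ring
      _ < 2 ^ (8 * (t + 1) ^ 3 + 2) := Nat.pow_lt_pow_right (by norm_num) (by omega)
      _ ≤ 2 ^ (n - 1 - (2 * n + 2) / 3) := Nat.pow_le_pow_right (by norm_num) hexp

/-- **Hence: nonzero (non-explicit) equations of the slice `{deg ≤ n, dc ≤ 2^{(log₂ n+1)³}}` exist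
eventually in `n`** — the class of 8746 with the admissible threshold `2^{(log₂ n+1)³}` is thin;
what 8746 asks beyond this is EXPLICITNESS.
[cite: HeintzSchnorr1980, existence of equations by dimension count] -/
theorem exists_equation_dcSlice_log3 : ∃ n₀ : ℕ, ∀ n ≥ n₀,
    ∃ D : MvPolynomial (degLEMonomials n) ℂ, D ≠ 0 ∧
      ∀ f : MvPolynomial (Fin n) ℂ, f.totalDegree ≤ n →
        determinantalComplexity f ≤ 2 ^ ((Nat.log 2 n + 1) ^ 3) →
          eval (coeffVector (degLEMonomials n) f) D = 0 := by
  obtain ⟨n₀, hn₀⟩ := exists_equation_log3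
  refine ⟨max n₀ 4, fun n hn => ?_⟩
  obtain ⟨D, hD0, hD⟩ := hn₀ n (le_of_max_le_left hn)
  exact ⟨D, hD0, fun f hfdeg hfdc =>
    hD f (dcSlice_subset_balanced_log3 (le_of_max_le_right hn) ⟨hfdeg, hfdc⟩)⟩


/-! ## §5 (appended) One target for the whole docket: the same hypothesis gives 8745 and 8749 -/

/-- **ONE circuit-free target for the docket**: level-`a` Boolean-sum equations for
`BP(n, 2^{8(log₂ n+1)³})`, eventually in `n`, give the CRUX `BarrierLever.DefinableEquations`
(stmt-8745) — through `definableDcEquations_of_balanced_equations` and the tree's glue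
`dcSliceCoversVP_proof : DefinableDcEquations → DefinableEquations`.
[cite: ForbesShpilkaVolk2018, Def. 1; ValiantSkyumBerkowitzRackoff1983, frontier identity] -/
theorem definableEquations_of_balanced_equations_log3
    (hE : ∃ a n₀ : ℕ, ∀ n ≥ n₀, ∃ q : ℕ, q ≤ (Nat.choose (2 * n) n) ^ a ∧
      ∃ H : MvPolynomial (↥(degLEMonomials n) ⊕ Fin q) ℂ,
        complexity H ≤ (Nat.choose (2 * n) n) ^ a ∧ H.totalDegree ≤ (Nat.choose (2 * n) n) ^ a ∧
        boolSum H ≠ 0 ∧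
        ∀ f ∈ {f : MvPolynomial (Fin n) ℂ | f.totalDegree ≤ n ∧ ∀ d : ℕ,
            ∃ g h : Fin (2 ^ (8 * (Nat.log 2 n + 1) ^ 3)) → MvPolynomial (Fin n) ℂ,
              (∀ i, (g i).totalDegree ≤ (2 * d + 2) / 3 ∧ (h i).totalDegree ≤ (2 * d + 2) / 3) ∧
              homogeneousComponent d f = ∑ i, g i * h i},
          eval (coeffVector (degLEMonomials n) f) (boolSum H) = 0) :
    Summit.ValiantsHypothesis.ValiantsHypothesis.Theses.BarrierLever.DefinableEquations :=
  Summit.ValiantsHypothesis.ValiantsHypothesis.Theorems.dcSliceCoversVP_proof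
    (definableDcEquations_of_balanced_equations hE)

/-- … and the SUPPORT item `BarrierLever.SingleSizeEquations` (stmt-8749), through the tree's
`SingleSizeEquations.singleSizeEquations_of_definableEquations`.
[cite: ForbesShpilkaVolk2018, Def. 1; ValiantSkyumBerkowitzRackoff1983, frontier identity] -/
theorem singleSizeEquations_of_balanced_equations_log3
    (hE : ∃ a n₀ : ℕ, ∀ n ≥ n₀, ∃ q : ℕ, q ≤ (Nat.choose (2 * n) n) ^ a ∧
      ∃ H : MvPolynomial (↥(degLEMonomials n) ⊕ Fin q) ℂ,
        complexity H ≤ (Nat.choose (2 * n) n) ^ a ∧ H.totalDegree ≤ (Nat.choose (2 * n) n) ^ a ∧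
        boolSum H ≠ 0 ∧
        ∀ f ∈ {f : MvPolynomial (Fin n) ℂ | f.totalDegree ≤ n ∧ ∀ d : ℕ,
            ∃ g h : Fin (2 ^ (8 * (Nat.log 2 n + 1) ^ 3)) → MvPolynomial (Fin n) ℂ,
              (∀ i, (g i).totalDegree ≤ (2 * d + 2) / 3 ∧ (h i).totalDegree ≤ (2 * d + 2) / 3) ∧
              homogeneousComponent d f = ∑ i, g i * h i},
          eval (coeffVector (degLEMonomials n) f) (boolSum H) = 0) :
    Summit.ValiantsHypothesis.ValiantsHypothesis.Theses.BarrierLever.SingleSizeEquations :=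
  Summit.ValiantsHypothesis.ValiantsHypothesis.Theorems.SingleSizeEquations.singleSizeEquations_of_definableEquations
    (definableEquations_of_balanced_equations_log3 hE)

end BalancedStrength

end Summit.ValiantsHypothesis.ValiantsHypothesis.Theorems.BarrierLeverDefinableEquations
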